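import Literature.NumberTheory.Automorphic.ArchEndoscopicChartOrbPlaces      -- ★ (P1) `chartOrbH_eq_prod_chartOrbHLoc`, ★ `isInvInvariant_of_isHaarMeasure_archOne`; brings ★ (T-MEAS) `chartOrbH`
import Literature.NumberTheory.Automorphic.ArchInnerFormChartOrbPlaces       -- ★ (G3) `chartOrbG_eq_prod_chartOrbGLoc`; brings ★ `chartOrbG`
import Literature.MeasureTheory.Group.InvariantQuotientScaling             -- ★ p850371: `quotientMeasure_smul_measure` (`(c • ν) ∕ ρ = c • (ν ∕ ρ)`)
import HarnessLib

/-!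
# `chartOrbH` and `chartOrbG` are LINEAR in the Haar measure; the factorisations (P1)∕(G3) for an ARBITRARY Haar measure
# ((PROD-QUOT-H∕G′) consumer corollaries: Folland 1995 §2.2 (uniqueness of Haar measure), §2.6 (2.52); Deitmar–Echterhoff 2014 Thm. 1.5.3; Rogawski 1990 §1.7, §8.2)

Topic `NumberTheory/Automorphic`; namespace `Literature.NumberTheory.Automorphic.UnitaryGroup`.  THEOREMS ONLY (no `def`, no instance, no notation, no axiom, no `sorry`).
Cell `pub/hodgecm-mathlib`, crux H413 (`stmt-HodgeConjecture-24833`), line LH3 (closer stub `stub_N9`, DIRECT ROAD), organs (PROD-QUOT-H)∕(PROD-QUOT-G′) (LH3-p03 (g3)); count-neutral.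
The organ statements of the line quantify over an ARBITRARY Haar measure `νH` on `H_∞` (resp. `ν′` on `G′_∞`), while ★ (P1) `chartOrbH_eq_prod_chartOrbHLoc` ∕ ★ (G3)
`chartOrbG_eq_prod_chartOrbGLoc` are stated under the product-measure convention.  The bridge is Haar uniqueness (Mathlib `isMulLeftInvariant_eq_smul`:
`νH = haarScalarFactor νH ν₀ • ν₀`) plus the linearity of the canonical quotient measure in the big measure (★ `quotientMeasure_smul_measure`):
* §1 `chartOrbH_measure_congr`, **`chartOrbH_smul_measure : chartOrbH L (κ • νH) S fH c = κ · chartOrbH L νH S fH c`**, `chartOrbH_eq_haarScalarFactor_mul`; the `G′` twins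
  `chartOrbG_measure_congr`, **`chartOrbG_smul_measure`**, `chartOrbG_eq_haarScalarFactor_mul`.
* §2 the product-measure convention IS a right-invariant Haar measure (`isHaarMeasure_prodConventionH`, `isMulRightInvariant_prodConventionH` and the `G′` twins), and
  **`chartOrbH_eq_haarScalarFactor_mul_prod_chartOrbHLoc`** ∕ **`chartOrbG_eq_haarScalarFactor_mul_prod_chartOrbGLoc`** — (P1)∕(G3) for an ARBITRARY Haar `νH`∕`ν′`, with the
  explicit positive constant `haarScalarFactor νH ν₀` (uniform in `S`, `c`, and the test function — hence invisible in every jump RATIO such as `jcH`, `jc′`).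
HONEST LABEL: HC_CM is proved only modulo the 7 printed citations (2 remaining: hLiu418 = `stmt-HodgeConjecture-24832`, h413 = `stmt-HodgeConjecture-24833`) until rung 0
closes; measure-theoretic bookkeeping, moves no row of the books.

## References
* [Folland1995] G. B. Folland, *A Course in Abstract Harmonic Analysis* (1995), §2.2 (uniqueness of Haar measure), §2.6 Thm. 2.49, (2.52).
* [DeitmarEchterhoff2014] A. Deitmar, S. Echterhoff, *Principles of Harmonic Analysis*, 2nd ed. (2014), Thm. 1.5.3.
* [Rogawski1990] J. D. Rogawski, *Automorphic Representations of Unitary Groups in Three Variables*, Ann. of Math. Stud. 123 (1990), §1.7 p. 6 (measures), §8.2 p. 122.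
* [BorelJacquet1979] A. Borel, H. Jacquet, *Automorphic forms and automorphic representations*, PSPM 33.1 (1979), §4.1.
-/

set_option autoImplicit false

noncomputable section

open MeasureTheory MeasureTheory.Measure NumberField NumberField.InfinitePlace Matrix Complex Topology
open Literature.MeasureTheory.Group
open scoped MatrixGroups Matrix Classical ENNReal NNReal

namespace Literature.NumberTheory.Automorphic.UnitaryGroup

/-- Right invariance passes along an isomorphism of measurable groups. [cite: Folland1995, §2.2] -/
private theorem isMulRightInvariant_map_mulEquiv' {A B : Type*} [Group A] [Group B] [MeasurableSpace A] [MeasurableSpace B]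
    [MeasurableMul A] [MeasurableMul B] (f : A ≃* B) (hf : Measurable f) (μ : Measure A) [μ.IsMulRightInvariant] :
    (Measure.map f μ).IsMulRightInvariant := by
  refine ⟨fun b => ?_⟩
  obtain ⟨a, rfl⟩ := f.surjective b
  rw [Measure.map_map (measurable_mul_const (f a)) hf]
  have h1 : (fun x => x * f a) ∘ ⇑f = ⇑f ∘ fun x => x * a := by
    funext x; simp only [Function.comp_apply, map_mul]
  rw [h1, ← Measure.map_map hf (measurable_mul_const a), map_mul_right_eq_self μ a]

/-! ## §1 Linearity in the Haar measure -/

section HSide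

variable (L : Type) [Field L] [NumberField L] [IsCMField L] (S : Finset {w : InfinitePlace L // IsComplex w})
  [MeasurableSpace (↥(arch (↥(maximalRealSubfield L)) L (IsCMField.complexConj L) 2 (Matrix.of fun i j : Fin 2 => if i.val + j.val + 1 = 2 then (1 : L) else 0)) ×
      ↥(arch (↥(maximalRealSubfield L)) L (IsCMField.complexConj L) 1 (Matrix.of fun i j : Fin 1 => if i.val + j.val + 1 = 1 then (1 : L) else 0)))]
  [BorelSpace (↥(arch (↥(maximalRealSubfield L)) L (IsCMField.complexConj L) 2 (Matrix.of fun i j : Fin 2 => if i.val + j.val + 1 = 2 then (1 : L) else 0)) ×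
      ↥(arch (↥(maximalRealSubfield L)) L (IsCMField.complexConj L) 1 (Matrix.of fun i j : Fin 1 => if i.val + j.val + 1 = 1 then (1 : L) else 0)))]

/-- `chartOrbH` reads the measure, not the instance witnesses: equal measures give equal functionals. [cite: Rogawski1990, §8.2 p. 122] -/
theorem chartOrbH_measure_congr
    {νH νH' : Measure (↥(arch (↥(maximalRealSubfield L)) L (IsCMField.complexConj L) 2 (Matrix.of fun i j : Fin 2 => if i.val + j.val + 1 = 2 then (1 : L) else 0)) ×
      ↥(arch (↥(maximalRealSubfield L)) L (IsCMField.complexConj L) 1 (Matrix.of fun i j : Fin 1 => if i.val + j.val + 1 = 1 then (1 : L) else 0)))}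
    [IsFiniteMeasureOnCompacts νH] [νH.IsMulRightInvariant] [IsFiniteMeasureOnCompacts νH'] [νH'.IsMulRightInvariant] (h : νH = νH')
    (fH : ↥(arch (↥(maximalRealSubfield L)) L (IsCMField.complexConj L) 2 (Matrix.of fun i j : Fin 2 => if i.val + j.val + 1 = 2 then (1 : L) else 0)) ×
      ↥(arch (↥(maximalRealSubfield L)) L (IsCMField.complexConj L) 1 (Matrix.of fun i j : Fin 1 => if i.val + j.val + 1 = 1 then (1 : L) else 0)) → ℂ)
    (c : {w : InfinitePlace L // IsComplex w} → Fin 3 → ℝ) : chartOrbH L νH S fH c = chartOrbH L νH' S fH c := by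
  subst h; rfl

variable (νH : Measure (↥(arch (↥(maximalRealSubfield L)) L (IsCMField.complexConj L) 2 (Matrix.of fun i j : Fin 2 => if i.val + j.val + 1 = 2 then (1 : L) else 0)) ×
      ↥(arch (↥(maximalRealSubfield L)) L (IsCMField.complexConj L) 1 (Matrix.of fun i j : Fin 1 => if i.val + j.val + 1 = 1 then (1 : L) else 0))))
  [νH.IsHaarMeasure] [νH.IsMulRightInvariant]

/-- **`chartOrbH` is linear in the Haar measure of `H_∞`**: `chartOrbH L (κ • νH) S fH c = κ · chartOrbH L νH S fH c` (`κ ≠ 0`; ★ `quotientMeasure_smul_measure`).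
[cite: DeitmarEchterhoff2014, Thm. 1.5.3] [cite: Folland1995, §2.6 (2.52)] -/
theorem chartOrbH_smul_measure {κ : ℝ≥0} (hκ : κ ≠ 0)
    (fH : ↥(arch (↥(maximalRealSubfield L)) L (IsCMField.complexConj L) 2 (Matrix.of fun i j : Fin 2 => if i.val + j.val + 1 = 2 then (1 : L) else 0)) ×
      ↥(arch (↥(maximalRealSubfield L)) L (IsCMField.complexConj L) 1 (Matrix.of fun i j : Fin 1 => if i.val + j.val + 1 = 1 then (1 : L) else 0)) → ℂ)
    (c : {w : InfinitePlace L // IsComplex w} → Fin 3 → ℝ) : chartOrbH L (κ • νH) S fH c = (κ : ℂ) * chartOrbH L νH S fH c := by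
  letI : MeasurableSpace ((↥(arch (↥(maximalRealSubfield L)) L (IsCMField.complexConj L) 2 (Matrix.of fun i j : Fin 2 => if i.val + j.val + 1 = 2 then (1 : L) else 0)) ×
      ↥(arch (↥(maximalRealSubfield L)) L (IsCMField.complexConj L) 1 (Matrix.of fun i j : Fin 1 => if i.val + j.val + 1 = 1 then (1 : L) else 0))) ⧸ chartTorusH L S) := borel _
  haveI : BorelSpace ((↥(arch (↥(maximalRealSubfield L)) L (IsCMField.complexConj L) 2 (Matrix.of fun i j : Fin 2 => if i.val + j.val + 1 = 2 then (1 : L) else 0)) ×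
      ↥(arch (↥(maximalRealSubfield L)) L (IsCMField.complexConj L) 1 (Matrix.of fun i j : Fin 1 => if i.val + j.val + 1 = 1 then (1 : L) else 0))) ⧸ chartTorusH L S) := ⟨rfl⟩
  haveI := locallyCompactSpace_chartTorusH L S
  haveI := isHaarMeasure_chartHaarH L S
  haveI := isInvInvariant_chartHaarH L S
  have h : quotientMeasure (chartTorusH L S) (chartHaarH L S) (isClosed_chartTorusH L S) (κ • νH) =
      (κ : ℝ≥0∞) • quotientMeasure (chartTorusH L S) (chartHaarH L S) (isClosed_chartTorusH L S) νH :=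
    quotientMeasure_smul_measure (chartTorusH L S) (isClosed_chartTorusH L S) (chartHaarH L S) νH (ENNReal.coe_ne_zero.mpr hκ) ENNReal.coe_ne_top
  rw [chartOrbH_def, chartOrbH_def]
  show ((chartHaarH L S (chartBoxImg L S)).toReal : ℂ) *
      ∫ y, descConj (endoTorus L S c) (chartTorusH L S) (forall_mem_chartTorusH_comm L S c) fH y
        ∂(quotientMeasure (chartTorusH L S) (chartHaarH L S) (isClosed_chartTorusH L S) (κ • νH)) =
    (κ : ℂ) * (((chartHaarH L S (chartBoxImg L S)).toReal : ℂ) *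
      ∫ y, descConj (endoTorus L S c) (chartTorusH L S) (forall_mem_chartTorusH_comm L S c) fH y
        ∂(quotientMeasure (chartTorusH L S) (chartHaarH L S) (isClosed_chartTorusH L S) νH))
  rw [h, integral_smul_measure, ENNReal.coe_toReal, Complex.real_smul]
  ring

/-- **`chartOrbH` for an ARBITRARY Haar measure in terms of a reference Haar measure `ν₀`**: `chartOrbH L νH = haarScalarFactor νH ν₀ · chartOrbH L ν₀` (Haar uniqueness,
Mathlib `isMulLeftInvariant_eq_smul`). [cite: Folland1995, §2.2] [cite: Rogawski1990, §1.7 p. 6] -/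
theorem chartOrbH_eq_haarScalarFactor_mul
    (ν₀ : Measure (↥(arch (↥(maximalRealSubfield L)) L (IsCMField.complexConj L) 2 (Matrix.of fun i j : Fin 2 => if i.val + j.val + 1 = 2 then (1 : L) else 0)) ×
      ↥(arch (↥(maximalRealSubfield L)) L (IsCMField.complexConj L) 1 (Matrix.of fun i j : Fin 1 => if i.val + j.val + 1 = 1 then (1 : L) else 0))))
    [ν₀.IsHaarMeasure] [ν₀.IsMulRightInvariant]
    (fH : ↥(arch (↥(maximalRealSubfield L)) L (IsCMField.complexConj L) 2 (Matrix.of fun i j : Fin 2 => if i.val + j.val + 1 = 2 then (1 : L) else 0)) ×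
      ↥(arch (↥(maximalRealSubfield L)) L (IsCMField.complexConj L) 1 (Matrix.of fun i j : Fin 1 => if i.val + j.val + 1 = 1 then (1 : L) else 0)) → ℂ)
    (c : {w : InfinitePlace L // IsComplex w} → Fin 3 → ℝ) :
    chartOrbH L νH S fH c = ((haarScalarFactor νH ν₀ : ℝ) : ℂ) * chartOrbH L ν₀ S fH c := by
  have hκ : haarScalarFactor νH ν₀ ≠ 0 := (haarScalarFactor_pos_of_isHaarMeasure νH ν₀).ne'
  rw [chartOrbH_measure_congr L S (isMulLeftInvariant_eq_smul νH ν₀) fH c, chartOrbH_smul_measure L S ν₀ hκ fH c]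

end HSide

section GSide

variable (L : Type) [Field L] [NumberField L] [IsCMField L] (α : Fin 3 → L) (S' : Finset {w : InfinitePlace L // IsComplex w})
  [MeasurableSpace ↥(arch (↥(maximalRealSubfield L)) L (IsCMField.complexConj L) 3 (Matrix.diagonal α))] [BorelSpace ↥(arch (↥(maximalRealSubfield L)) L (IsCMField.complexConj L) 3 (Matrix.diagonal α))]

/-- `chartOrbG` reads the measure, not the instance witnesses. [cite: Rogawski1990, §8.2 p. 122] -/
theorem chartOrbG_measure_congr {ν' ν'' : Measure ↥(arch (↥(maximalRealSubfield L)) L (IsCMField.complexConj L) 3 (Matrix.diagonal α))}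
    [IsFiniteMeasureOnCompacts ν'] [ν'.IsMulRightInvariant] [IsFiniteMeasureOnCompacts ν''] [ν''.IsMulRightInvariant] (h : ν' = ν'')
    (a' : ↥(arch (↥(maximalRealSubfield L)) L (IsCMField.complexConj L) 3 (Matrix.diagonal α)) → ℂ) (c : {w : InfinitePlace L // IsComplex w} → Fin 3 → ℝ) :
    chartOrbG L α ν' S' a' c = chartOrbG L α ν'' S' a' c := by
  subst h; rfl

variable (ν' : Measure ↥(arch (↥(maximalRealSubfield L)) L (IsCMField.complexConj L) 3 (Matrix.diagonal α))) [ν'.IsHaarMeasure] [ν'.IsMulRightInvariant]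

/-- **`chartOrbG` is linear in the Haar measure of `G′_∞`.** [cite: DeitmarEchterhoff2014, Thm. 1.5.3] [cite: Folland1995, §2.6 (2.52)] -/
theorem chartOrbG_smul_measure {κ : ℝ≥0} (hκ : κ ≠ 0)
    (a' : ↥(arch (↥(maximalRealSubfield L)) L (IsCMField.complexConj L) 3 (Matrix.diagonal α)) → ℂ) (c : {w : InfinitePlace L // IsComplex w} → Fin 3 → ℝ) :
    chartOrbG L α (κ • ν') S' a' c = (κ : ℂ) * chartOrbG L α ν' S' a' c := by
  letI : MeasurableSpace (↥(arch (↥(maximalRealSubfield L)) L (IsCMField.complexConj L) 3 (Matrix.diagonal α)) ⧸ chartTorusG L α S') := borel _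
  haveI : BorelSpace (↥(arch (↥(maximalRealSubfield L)) L (IsCMField.complexConj L) 3 (Matrix.diagonal α)) ⧸ chartTorusG L α S') := ⟨rfl⟩
  haveI := locallyCompactSpace_chartTorusG L α S'
  haveI := isHaarMeasure_chartHaarG L α S'
  haveI := isInvInvariant_chartHaarG L α S'
  have h : quotientMeasure (chartTorusG L α S') (chartHaarG L α S') (isClosed_chartTorusG L α S') (κ • ν') =
      (κ : ℝ≥0∞) • quotientMeasure (chartTorusG L α S') (chartHaarG L α S') (isClosed_chartTorusG L α S') ν' :=
    quotientMeasure_smul_measure (chartTorusG L α S') (isClosed_chartTorusG L α S') (chartHaarG L α S') ν' (ENNReal.coe_ne_zero.mpr hκ) ENNReal.coe_ne_top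
  rw [chartOrbG_def, chartOrbG_def]
  show ((chartHaarG L α S' (chartBoxImgG L α S')).toReal : ℂ) *
      ∫ y, descConj (gprimeTorus L α S' c) (chartTorusG L α S') (forall_mem_chartTorusG_comm L α S' c) a' y
        ∂(quotientMeasure (chartTorusG L α S') (chartHaarG L α S') (isClosed_chartTorusG L α S') (κ • ν')) =
    (κ : ℂ) * (((chartHaarG L α S' (chartBoxImgG L α S')).toReal : ℂ) *
      ∫ y, descConj (gprimeTorus L α S' c) (chartTorusG L α S') (forall_mem_chartTorusG_comm L α S' c) a' y
        ∂(quotientMeasure (chartTorusG L α S') (chartHaarG L α S') (isClosed_chartTorusG L α S') ν'))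
  rw [h, integral_smul_measure, ENNReal.coe_toReal, Complex.real_smul]
  ring

/-- **`chartOrbG` for an ARBITRARY Haar measure in terms of a reference Haar measure `ν₀`.** [cite: Folland1995, §2.2] [cite: Rogawski1990, §1.7 p. 6] -/
theorem chartOrbG_eq_haarScalarFactor_mul (ν₀ : Measure ↥(arch (↥(maximalRealSubfield L)) L (IsCMField.complexConj L) 3 (Matrix.diagonal α))) [ν₀.IsHaarMeasure] [ν₀.IsMulRightInvariant]
    (a' : ↥(arch (↥(maximalRealSubfield L)) L (IsCMField.complexConj L) 3 (Matrix.diagonal α)) → ℂ) (c : {w : InfinitePlace L // IsComplex w} → Fin 3 → ℝ) :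
    chartOrbG L α ν' S' a' c = ((haarScalarFactor ν' ν₀ : ℝ) : ℂ) * chartOrbG L α ν₀ S' a' c := by
  have hκ : haarScalarFactor ν' ν₀ ≠ 0 := (haarScalarFactor_pos_of_isHaarMeasure ν' ν₀).ne'
  rw [chartOrbG_measure_congr L α S' (isMulLeftInvariant_eq_smul ν' ν₀) a' c, chartOrbG_smul_measure L α S' ν₀ hκ a' c]

end GSide

/-! ## §2 The product-measure conventions are right-invariant Haar measures; (P1)∕(G3) for an arbitrary Haar measure -/

section Convention

variable (L : Type) [Field L] [NumberField L] [IsCMField L]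
  [∀ w : {w : InfinitePlace L // IsComplex w}, MeasurableSpace ↥(archLocal L 2 (Matrix.of fun i j : Fin 2 => if i.val + j.val + 1 = 2 then (1 : L) else 0) w)]
  [∀ w : {w : InfinitePlace L // IsComplex w}, BorelSpace ↥(archLocal L 2 (Matrix.of fun i j : Fin 2 => if i.val + j.val + 1 = 2 then (1 : L) else 0) w)]
  [MeasurableSpace ↥(arch (↥(maximalRealSubfield L)) L (IsCMField.complexConj L) 2 (Matrix.of fun i j : Fin 2 => if i.val + j.val + 1 = 2 then (1 : L) else 0))]
  [BorelSpace ↥(arch (↥(maximalRealSubfield L)) L (IsCMField.complexConj L) 2 (Matrix.of fun i j : Fin 2 => if i.val + j.val + 1 = 2 then (1 : L) else 0))]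
  [MeasurableSpace ↥(arch (↥(maximalRealSubfield L)) L (IsCMField.complexConj L) 1 (Matrix.of fun i j : Fin 1 => if i.val + j.val + 1 = 1 then (1 : L) else 0))]
  [BorelSpace ↥(arch (↥(maximalRealSubfield L)) L (IsCMField.complexConj L) 1 (Matrix.of fun i j : Fin 1 => if i.val + j.val + 1 = 1 then (1 : L) else 0))]
  (νw : ∀ w : {w : InfinitePlace L // IsComplex w}, Measure ↥(archLocal L 2 (Matrix.of fun i j : Fin 2 => if i.val + j.val + 1 = 2 then (1 : L) else 0) w))
  [∀ w, (νw w).IsHaarMeasure] [∀ w, (νw w).IsMulRightInvariant]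
  (νB : Measure ↥(arch (↥(maximalRealSubfield L)) L (IsCMField.complexConj L) 1 (Matrix.of fun i j : Fin 1 => if i.val + j.val + 1 = 1 then (1 : L) else 0)))
  [νB.IsHaarMeasure] [νB.IsMulRightInvariant]

omit [∀ w, (νw w).IsMulRightInvariant] [νB.IsMulRightInvariant] in
/-- **The product-measure convention of (P1) is a Haar measure on `H_∞`** (Mathlib `Measure.pi.isHaarMeasure`, `ContinuousMulEquiv.isHaarMeasure_map`, `prod.instIsHaarMeasure`).
[cite: BorelJacquet1979, §4.1] [cite: Rogawski1990, §1.7 p. 6] -/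
theorem isHaarMeasure_prodConventionH :
    (((Measure.pi νw).map (archPiEquivCM 2 L (Matrix.of fun i j : Fin 2 => if i.val + j.val + 1 = 2 then (1 : L) else 0)).symm).prod νB).IsHaarMeasure := by
  haveI : ∀ w : {w : InfinitePlace L // IsComplex w}, LocallyCompactSpace ↥(archLocal L 2 (Matrix.of fun i j : Fin 2 => if i.val + j.val + 1 = 2 then (1 : L) else 0) w) :=
    fun w => locallyCompactSpace_archLocal_two L w
  haveI : ∀ w : {w : InfinitePlace L // IsComplex w}, SecondCountableTopology ↥(archLocal L 2 (Matrix.of fun i j : Fin 2 => if i.val + j.val + 1 = 2 then (1 : L) else 0) w) :=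
    fun w => secondCountableTopology_archLocal_two L w
  haveI : ((Measure.pi νw).map (archPiEquivCM 2 L (Matrix.of fun i j : Fin 2 => if i.val + j.val + 1 = 2 then (1 : L) else 0)).symm).IsHaarMeasure :=
    ContinuousMulEquiv.isHaarMeasure_map (Measure.pi νw) (archPiEquivCM 2 L _).symm
  infer_instance

/-- The product-measure convention of (P1) is right invariant. [cite: BorelJacquet1979, §4.1] -/
theorem isMulRightInvariant_prodConventionH :
    (((Measure.pi νw).map (archPiEquivCM 2 L (Matrix.of fun i j : Fin 2 => if i.val + j.val + 1 = 2 then (1 : L) else 0)).symm).prod νB).IsMulRightInvariant := by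
  haveI : ∀ w : {w : InfinitePlace L // IsComplex w}, LocallyCompactSpace ↥(archLocal L 2 (Matrix.of fun i j : Fin 2 => if i.val + j.val + 1 = 2 then (1 : L) else 0) w) :=
    fun w => locallyCompactSpace_archLocal_two L w
  haveI : ∀ w : {w : InfinitePlace L // IsComplex w}, SecondCountableTopology ↥(archLocal L 2 (Matrix.of fun i j : Fin 2 => if i.val + j.val + 1 = 2 then (1 : L) else 0) w) :=
    fun w => secondCountableTopology_archLocal_two L w
  haveI : ∀ w, SigmaFinite (νw w) := fun w => inferInstance
  haveI : (Measure.pi νw).IsMulRightInvariant := inferInstance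
  haveI := isHaarMeasure_prodConventionH L νw νB
  haveI : ((Measure.pi νw).map (archPiEquivCM 2 L (Matrix.of fun i j : Fin 2 => if i.val + j.val + 1 = 2 then (1 : L) else 0)).symm).IsMulRightInvariant :=
    isMulRightInvariant_map_mulEquiv' (archPiEquivCM 2 L _).symm.toMulEquiv (archPiEquivCM 2 L _).symm.continuous.measurable _
  infer_instance

variable (S : Finset {w : InfinitePlace L // IsComplex w})
  (νH : Measure (↥(arch (↥(maximalRealSubfield L)) L (IsCMField.complexConj L) 2 (Matrix.of fun i j : Fin 2 => if i.val + j.val + 1 = 2 then (1 : L) else 0)) ×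
      ↥(arch (↥(maximalRealSubfield L)) L (IsCMField.complexConj L) 1 (Matrix.of fun i j : Fin 1 => if i.val + j.val + 1 = 1 then (1 : L) else 0))))
  [νH.IsHaarMeasure] [νH.IsMulRightInvariant]

/-- **(P1) FOR AN ARBITRARY HAAR MEASURE `νH` ON `H_∞`**: with `ν₀` the product-measure convention built from `ν_w`, `ν_B`, for every product test function
`fH (a, b) = (Π_w f_w ((eA a)_w)) · g b`, every `S` and EVERY `c`,
`chartOrbH L νH S fH c = haarScalarFactor νH ν₀ · ν_B(B) · g((endoTorus L S c).2) · Π_w chartOrbHLoc L S w ν_w f_w (c w)` — the constant is positive and depends on the measures only.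
[cite: Folland1995, §2.2; §2.6 (2.52)] [cite: BorelJacquet1979, §4.1] [cite: Rogawski1990, §8.2 p. 122] -/
theorem chartOrbH_eq_haarScalarFactor_mul_prod_chartOrbHLoc
    (fH : ↥(arch (↥(maximalRealSubfield L)) L (IsCMField.complexConj L) 2 (Matrix.of fun i j : Fin 2 => if i.val + j.val + 1 = 2 then (1 : L) else 0)) ×
      ↥(arch (↥(maximalRealSubfield L)) L (IsCMField.complexConj L) 1 (Matrix.of fun i j : Fin 1 => if i.val + j.val + 1 = 1 then (1 : L) else 0)) → ℂ)
    (f : ∀ w : {w : InfinitePlace L // IsComplex w}, ↥(archLocal L 2 (Matrix.of fun i j : Fin 2 => if i.val + j.val + 1 = 2 then (1 : L) else 0) w) → ℂ)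
    (g : ↥(arch (↥(maximalRealSubfield L)) L (IsCMField.complexConj L) 1 (Matrix.of fun i j : Fin 1 => if i.val + j.val + 1 = 1 then (1 : L) else 0)) → ℂ)
    (hfH : ∀ a b, fH (a, b) = (∏ w, f w (archPiEquivCM 2 L (Matrix.of fun i j : Fin 2 => if i.val + j.val + 1 = 2 then (1 : L) else 0) a w)) * g b)
    (c : {w : InfinitePlace L // IsComplex w} → Fin 3 → ℝ) :
    haveI := isHaarMeasure_prodConventionH L νw νB
    chartOrbH L νH S fH c =
      ((haarScalarFactor νH (((Measure.pi νw).map (archPiEquivCM 2 L (Matrix.of fun i j : Fin 2 => if i.val + j.val + 1 = 2 then (1 : L) else 0)).symm).prod νB) : ℝ) : ℂ) *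
        ((νB.real Set.univ : ℂ) * g (endoTorus L S c).2 * ∏ w, chartOrbHLoc L S w (νw w) (f w) (c w)) := by
  haveI := isHaarMeasure_prodConventionH L νw νB
  haveI := isMulRightInvariant_prodConventionH L νw νB
  rw [chartOrbH_eq_haarScalarFactor_mul L S νH (((Measure.pi νw).map (archPiEquivCM 2 L (Matrix.of fun i j : Fin 2 => if i.val + j.val + 1 = 2 then (1 : L) else 0)).symm).prod νB) fH c,
    chartOrbH_eq_prod_chartOrbHLoc L S νw νB _ rfl fH f g hfH c]

end Convention

section ConventionG

variable (L : Type) [Field L] [NumberField L] [IsCMField L] (α : Fin 3 → L)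
  [∀ w : {w : InfinitePlace L // IsComplex w}, MeasurableSpace ↥(archLocal L 3 (Matrix.diagonal α) w)]
  [∀ w : {w : InfinitePlace L // IsComplex w}, BorelSpace ↥(archLocal L 3 (Matrix.diagonal α) w)]
  [MeasurableSpace ↥(arch (↥(maximalRealSubfield L)) L (IsCMField.complexConj L) 3 (Matrix.diagonal α))]
  [BorelSpace ↥(arch (↥(maximalRealSubfield L)) L (IsCMField.complexConj L) 3 (Matrix.diagonal α))]
  (ν'w : ∀ w : {w : InfinitePlace L // IsComplex w}, Measure ↥(archLocal L 3 (Matrix.diagonal α) w)) [∀ w, (ν'w w).IsHaarMeasure] [∀ w, (ν'w w).IsMulRightInvariant]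

omit [∀ w, (ν'w w).IsMulRightInvariant] in
/-- The product-measure convention of (G3) is a Haar measure on `G′_∞`. [cite: BorelJacquet1979, §4.1] [cite: Rogawski1990, §1.7 p. 6] -/
theorem isHaarMeasure_prodConventionG : ((Measure.pi ν'w).map (archPiEquivCM 3 L (Matrix.diagonal α)).symm).IsHaarMeasure := by
  haveI : ∀ w : {w : InfinitePlace L // IsComplex w}, LocallyCompactSpace ↥(archLocal L 3 (Matrix.diagonal α) w) := fun w => locallyCompactSpace_archLocal_three L α w
  haveI : ∀ w : {w : InfinitePlace L // IsComplex w}, SecondCountableTopology ↥(archLocal L 3 (Matrix.diagonal α) w) := fun w => secondCountableTopology_archLocal_three L α w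
  exact ContinuousMulEquiv.isHaarMeasure_map (Measure.pi ν'w) (archPiEquivCM 3 L _).symm

/-- The product-measure convention of (G3) is right invariant. [cite: BorelJacquet1979, §4.1] -/
theorem isMulRightInvariant_prodConventionG : ((Measure.pi ν'w).map (archPiEquivCM 3 L (Matrix.diagonal α)).symm).IsMulRightInvariant := by
  haveI : ∀ w : {w : InfinitePlace L // IsComplex w}, LocallyCompactSpace ↥(archLocal L 3 (Matrix.diagonal α) w) := fun w => locallyCompactSpace_archLocal_three L α w
  haveI : ∀ w : {w : InfinitePlace L // IsComplex w}, SecondCountableTopology ↥(archLocal L 3 (Matrix.diagonal α) w) := fun w => secondCountableTopology_archLocal_three L α w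
  haveI : ∀ w, SigmaFinite (ν'w w) := fun w => inferInstance
  haveI : (Measure.pi ν'w).IsMulRightInvariant := inferInstance
  exact isMulRightInvariant_map_mulEquiv' (archPiEquivCM 3 L _).symm.toMulEquiv (archPiEquivCM 3 L _).symm.continuous.measurable _

variable (S' : Finset {w : InfinitePlace L // IsComplex w})
  (ν' : Measure ↥(arch (↥(maximalRealSubfield L)) L (IsCMField.complexConj L) 3 (Matrix.diagonal α))) [ν'.IsHaarMeasure] [ν'.IsMulRightInvariant]

/-- **(G3) FOR AN ARBITRARY HAAR MEASURE `ν′` ON `G′_∞`** (diagonal frame, `hα`, admissible `S′`): for every product test function `a′ g = Π_w f_w((e g)_w)` and EVERY `c`,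
`chartOrbG L α ν′ S′ a′ c = haarScalarFactor ν′ ν₀ · Π_w chartOrbGLoc L α w S′ ν′_w f_w (c w)`, `ν₀ = e⁻¹_* ⊗_w ν′_w`. [cite: Folland1995, §2.2; §2.6 (2.52)] [cite: BorelJacquet1979, §4.1]
[cite: Rogawski1990, §8.2 p. 122] -/
theorem chartOrbG_eq_haarScalarFactor_mul_prod_chartOrbGLoc (hα : ∀ i, α i ≠ 0) (hS' : ∀ w, w ∈ S' → w ∈ splitChartPlaces L α)
    (a' : ↥(arch (↥(maximalRealSubfield L)) L (IsCMField.complexConj L) 3 (Matrix.diagonal α)) → ℂ)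
    (f : ∀ w : {w : InfinitePlace L // IsComplex w}, ↥(archLocal L 3 (Matrix.diagonal α) w) → ℂ)
    (ha' : ∀ g, a' g = ∏ w, f w (archPiEquivCM 3 L (Matrix.diagonal α) g w)) (c : {w : InfinitePlace L // IsComplex w} → Fin 3 → ℝ) :
    haveI := isHaarMeasure_prodConventionG L α ν'w
    chartOrbG L α ν' S' a' c =
      ((haarScalarFactor ν' ((Measure.pi ν'w).map (archPiEquivCM 3 L (Matrix.diagonal α)).symm) : ℝ) : ℂ) * ∏ w, chartOrbGLoc L α w S' (ν'w w) (f w) (c w) := by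
  haveI := isHaarMeasure_prodConventionG L α ν'w
  haveI := isMulRightInvariant_prodConventionG L α ν'w
  rw [chartOrbG_eq_haarScalarFactor_mul L α S' ν' ((Measure.pi ν'w).map (archPiEquivCM 3 L (Matrix.diagonal α)).symm) a' c,
    chartOrbG_eq_prod_chartOrbGLoc L α S' ν'w _ rfl hα hS' a' f ha' c]

end ConventionG

end Literature.NumberTheory.Automorphic.UnitaryGroup

end
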